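import Summits.BirchSwinnertonDyer.BirchSwinnertonDyer.Theorems.ErratumRoadFiveNonSurjCornerTateLines
import Literature.NumberTheory.EllipticCurves.TateCurve.NumberFieldUniformizationTwisted
import Literature.NumberTheory.EllipticCurves.TateCurve.MultiplicativeTwistUnramifiedProofs
import Literature.NumberTheory.EllipticCurves.CongruenceVisibilityMultiplicativeTwisted
import Literature.NumberTheory.EllipticCurves.UnramifiedLayerRootsProofs
import Literature.NumberTheory.EllipticCurves.SelmerInertiaProofs
import HarnessLib

/-!
# The local Kummer condition at a NON-SPLIT multiplicative place `v ∤ p` (`p` odd) is unramified;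
# kind (iv) of the congruence-visibility certificate («`E` good, `E'` non-split multiplicative») WITHOUT
# the named fact `Fisher2016.thm44_selmerLocalKer_iff_of_nonsplit_good`

Route `SemiOrdinaryEisensteinDescent` (SOED), crux of record E_𝟙^V `WildSplitEisensteinValueAtOneV`
(stmt-BirchSwinnertonDyer-26610), width seat bsd-wall-soed-p1-w3 g22 (`--supports 26610 --as helper`). THEOREMS ONLY
(no definition, no named fact, standard axioms). Purpose: the in-range content row `412317d1` of the crux
(`Theorems/…VisibleOwnPoint412317d1.lean`, p649940) displays the binder `hF44 : thm44_selmerLocalKer_iff_of_nonsplit_good`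
(Fisher, LMS J. Comput. Math. 19 (2016) Thm. 4.4) for its place `2` of kind (iv): `E = 412317d1` GOOD at `2`, the
`3`-congruent partner `F = 274878a1` NON-SPLIT multiplicative at `2`. This file PROVES the projection of Theorem 4.4 that the
record consumes, for every number field, so that the row can be re-landed fact-free (sequel file `…412317d1FactFree`).

## The theorems

* `selmerLocalKerOfEmb_le_unramifiedKer_primeBelow_of_nonsplit` / `selmerLocalKer_le_unramifiedKer_of_nonsplit`
  (**M**): `K` a number field, `F = W` an elliptic curve over `K`, `p` an ODD prime, `v ∤ p` a finite place at which `F`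
  has NON-SPLIT multiplicative reduction, `𝔓` any prime of `\bar ℤ_K` above `v`. Then
  `selmerLocalKer F K_v p ≤ unramifiedKer F[p] 𝔓`: a global class dying in `H¹(K_v, F)` is unramified at `v`
  (the image of the local Kummer map `F(K_v)/p ↪ H¹(K_v, F[p])` consists of unramified classes). Informally:
  the component group of a non-split `I_n` has `≤ 2` rational points, so for odd `p` every rational point is
  `p`-divisible in `F(K_v^nr)` (Schaefer–Stoll, *How to do a p-descent*, Prop. 3.2 / Milne *ADT* I 3.8: the index of the
  unramified part in the Kummer image divides `c_v`). NO hypothesis «`F[p]` unramified».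
* `h1Equiv_mem_selmerLocalKer_of_hasGoodReductionAt_of_nonsplit` (**C1**, kind (iv), orientation «`E` good, `E'`
  non-split multiplicative», `v ∤ p`, `p` odd): for a `Γ_K`-isomorphism `θ : E'[p] ⥲ E[p]` and
  `c ∈ 𝓢_v(E')`, `θ_* c ∈ 𝓢_v(E)` — by **M**, transport of unramifiedness (`mem_unramifiedKer_iff_h1Equiv_mem`)
  and Gross's (7.1) at the good place (`selmerLocalKer_eq_unramifiedKer`). This is EXACTLY the use of
  `Fisher2016.selmerLocalKer_le_of_nonsplit_good … (Or.inl «v ∤ p») (Or.inr ⟨E good, E' mult, E' non-split⟩)` in the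
  412317d1 record, now unconditional; `relIndex_map_selmerLocalKer_eq_one_of_hasGoodReductionAt_of_nonsplit` is the
  `ι_v(θ) = 1` form of `CongruenceVisibilityComparison`.

## Proof of M (Tate curve; Silverman *ATAEC* V.3–V.5, all inputs PROVED in the tree)

Fix an embedding `ι : K̄ → K̄_v`, a prime `𝔐` of `\bar 𝓞_v`, and a class `c = [φ]` with `ι_* φ(res σ) = σa − a` on
`Γ_{K_v}` (`a ∈ F(K̄_v)`); `P = p·a` is `Γ_{K_v}`-rational. Twisted uniformisation
(`Silverman1994_thmV53_corV54_tateUniformisation_holds`, Cor. V.5.4 clause): `P = Ψ(u)` with `u ∈ K̄_v^×` fixed by every `σ`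
fixing `t = √γ`, and `u·σ₀(u) = q^m` for any `σ₀` moving `t`; such a `σ₀` EXISTS because the reduction is non-split
(`exists_toAlgEquiv_ne_of_not_split`, V.5.3 (b)). KEY IDENTITY (`p = 2k − 1`):
`u · q^{−mk} = ν^k · (u⁻¹)^p` with `ν = u² q^{−m} = u/σ₀(u)`, a UNIT of `K̄_v` (`|σ₀ u| = |u|`). Let `ρ^p = ν^k` and
`Q = Ψ(ρ u⁻¹)`: then `p·Q = Ψ(u q^{−mk}) = P`. The inertia group `I_𝔐` fixes `t` (V.5.3 (b)/Ex. 5.11, tree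
`toAlgEquiv_eq_of_mem_inertia_of_sq_eq_gamma`), hence `u` and `ν`; it fixes the `p`-th root `ρ` of the `I_𝔐`-invariant unit
`ν^k` because `p ∤ v` (roots of `X^p − ν^k` are distinct mod `𝔐`; Lang *FDG* Ch. 6 Prop. 1.3); so `I_𝔐` fixes `Q`
(sign `χ = 1` on `I_𝔐`). With `T = a − Q ∈ F(K̄_v)[p] = ι_* F[p]`, `T = ι_* T₀`, and local–global compatibility of inertia
(`exists_mem_inertia_apply_eq_holds`, Neukirch II (9.6)): `φ(τ) = τ T₀ − T₀` on `I_𝔓`, `𝔓 = 𝔓_{ι,𝔐}` — a coboundary.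
The passage to an arbitrary `𝔓 ∣ v` is that of `selmerLocalKer_le_unramifiedKer` (transitivity of `Γ_K` on the primes
above `v`, independence of the embedding).

BSD is not proved by any of this; nothing here is specific to the crux except its consumer.

## References
* [Fisher2016Visualizing7] T. Fisher, LMS J. Comput. Math. 19 (2016) Suppl. A, Thm. 4.4 (p. 106).
* [SilvermanATAEC1994] J. H. Silverman, *ATAEC*, GTM 151, Ch. V Lemma 5.2, Thm. 5.3, Cor. 5.4, Ex. 5.11.
* [Lang1983] S. Lang, *Fundamentals of Diophantine Geometry*, Ch. 6 Prop. 1.3.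
* [MilneADT2006] J. S. Milne, *Arithmetic Duality Theorems*, I Prop. 3.8.
* [GrossLMS1991] B. H. Gross, *Kolyvagin's work on modular elliptic curves*, §7 (7.1).
* [NeukirchANT1999] J. Neukirch, *Algebraic Number Theory*, II (9.6).
-/

set_option autoImplicit false
-- the conventional namespace `Summit.BirchSwinnertonDyer.BirchSwinnertonDyer.Theorems.…` repeats the summit name
set_option linter.dupNamespace false

noncomputable section

open scoped Classical NNReal Pointwise

open NumberField IsDedekindDomain Field WeierstrassCurve
open Literature.NumberTheory.EllipticCurves Literature.NumberTheory.GaloisRepresentations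
open IsDedekindDomain.HeightOneSpectrum

namespace Summit.BirchSwinnertonDyer.BirchSwinnertonDyer.Theorems.NonsplitKummerUnramified

variable {K : Type} [Field K] [NumberField K] (W : WeierstrassCurve K) [W.IsElliptic]

/-! ### §0 Torsion of `E(K̄_v)` comes from `E[n](K̄)` along ANY embedding -/

/-- **`ι_* : E[n](K̄) → E(K̄_E)[n]` is onto for every `K`-embedding `ι : K̄ → K̄_E`** (`n ≠ 0`): it is injective and both
groups have `|n|²` elements (Silverman *AEC* III.6.4 (b); the tree's `torsionPointsEquiv` is the case of the chosen embedding).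
[cite: SilvermanAEC2009, Cor. III.6.4(b)] -/
theorem exists_geomTorsion_pointsMapOfEmb_eq {n : ℤ} (hn : n ≠ 0) {E : Type} [Field E] [Algebra K E]
    (ι : AlgebraicClosure K →ₐ[K] AlgebraicClosure E) {T : localPoints W E} (hT : n • T = 0) :
    ∃ T₀ : geomTorsion W n, pointsMapOfEmb W ι (T₀ : geomPoints W) = T := by
  haveI : Finite (AddSubgroup.torsionBy (localPoints W E) n) :=
    finite_torsionPoints_holds W (AlgebraicClosure E) hn
  set f : geomTorsion W n → AddSubgroup.torsionBy (localPoints W E) n := fun P ↦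
    ⟨pointsMapOfEmb W ι (P : geomPoints W), (Submodule.mem_torsionBy_iff _ _).mpr (by
      change n • pointsMapOfEmb W ι (P : geomPoints W) = 0
      rw [← map_zsmul, (mem_geomTorsion_iff W n _).mp P.2, map_zero])⟩ with hf
  have hinj : Function.Injective f := by
    intro P Q h
    apply Subtype.ext
    apply pointsMapOfEmb_injective W ι
    exact congrArg (fun R : AddSubgroup.torsionBy (localPoints W E) n ↦ (R : localPoints W E)) h
  have hbij : Function.Bijective f :=
    (Nat.bijective_iff_injective_and_card f).mpr
      ⟨hinj, by rw [W.natCard_geomTorsion n hn, W.natCard_torsionBy_localPoints n hn]⟩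
  obtain ⟨T₀, hT₀⟩ := hbij.2 ⟨T, (Submodule.mem_torsionBy_iff _ _).mpr hT⟩
  exact ⟨T₀, congrArg (fun R : AddSubgroup.torsionBy (localPoints W E) n ↦ (R : localPoints W E)) hT₀⟩

/-! ### §1 Theorem M at the prime cut out by an embedding -/

variable {p : ℕ} [hp : Fact p.Prime] (v : HeightOneSpectrum (𝓞 K))

/-- **M (local form at one embedding).** `F = W` elliptic over a number field `K`, `p` odd, `v ∤ p` a place of NON-SPLIT
multiplicative reduction, `ι : K̄ → K̄_v`, `𝔐` a prime of `\bar 𝓞_v` over `𝓂_v`: every class of `H¹(K, F[p])` dying in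
`H¹(K_v, F)` along `ι` is unramified at `𝔓_{ι,𝔐}`. Proof in the module docstring (twisted Tate uniformisation, the unit
`ν = u/σ₀u`, the identity `u q^{−mk} = ν^k (u⁻¹)^p`, inertia fixes `√γ` and the `p`-th roots of invariant units).
[cite: SilvermanATAEC1994, Ch. V Lemma 5.2 (c), Thm. 5.3, Cor. 5.4, Ex. 5.11] [cite: Lang1983, Ch. 6 Prop. 1.3]
[cite: Fisher2016Visualizing7, Thm. 4.4 (p. 106)] -/
theorem selmerLocalKerOfEmb_le_unramifiedKer_primeBelow_of_nonsplit (hp2 : p ≠ 2)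
    (hv : (p : 𝓞 K) ∉ v.asIdeal) (hmult : W.HasMultiplicativeReductionAt v)
    (hns : ¬ W.HasSplitMultiplicativeReductionAt v)
    (ι : AlgebraicClosure K →ₐ[K] AlgebraicClosure (v.adicCompletion K))
    {𝔐 : Ideal v.localAbsIntegers} (h𝔐 : 𝔐 ∈ v.localPrimesAbove) :
    selmerLocalKerOfEmb W (v.adicCompletion K) ι (p : ℤ) ≤
      unramifiedKer (geomTorsion W (p : ℤ)) (v.primeBelow ι 𝔐) := by
  intro c hc
  have hpp : p.Prime := hp.out
  haveI : NeZero p := ⟨hpp.ne_zero⟩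
  haveI : CharZero (v.adicCompletion K) :=
    charZero_of_injective_algebraMap (algebraMap K (v.adicCompletion K)).injective
  haveI : CharZero (AlgebraicClosure (v.adicCompletion K)) := charZero_of_injective_algebraMap
    (algebraMap (v.adicCompletion K) (AlgebraicClosure (v.adicCompletion K))).injective
  have hn : (p : ℤ) ≠ 0 := by exact_mod_cast hpp.ne_zero
  obtain ⟨k, hk⟩ : ∃ k : ℕ, p + 1 = 2 * k := by
    obtain ⟨j, hj⟩ := hpp.odd_of_ne_two hp2
    exact ⟨j + 1, by omega⟩
  obtain ⟨w, hw⟩ := v.exists_spectralValuation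
  -- the Galois action on `K̄_v` is that of `toAlgEquiv`
  have hτ : ∀ (σ : absoluteGaloisGroup (v.adicCompletion K)) (y : AlgebraicClosure (v.adicCompletion K)),
      σ • y = absoluteGaloisGroup.toAlgEquiv (v.adicCompletion K) σ y := fun _ _ ↦ rfl
  -- the twisted Tate uniformisation at `v` (PROVED named fact)
  obtain ⟨q, t, Ψ, hq0, -, -, ht2, -, hker, hequiv, hrat⟩ :=
    TateCurve.Silverman1994_thmV53_corV54_tateUniformisation_holds W v hmult
  set qh : AlgebraicClosure (v.adicCompletion K) :=
    algebraMap (v.adicCompletion K) (AlgebraicClosure (v.adicCompletion K)) q with hqh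
  have hqh0 : qh ≠ 0 := by
    rw [hqh]
    exact (map_ne_zero_iff _ (algebraMap (v.adicCompletion K)
      (AlgebraicClosure (v.adicCompletion K))).injective).mpr hq0
  -- the inertia group fixes `t = √γ`
  have hIt : ∀ σ ∈ 𝔐.inertia (absoluteGaloisGroup (v.adicCompletion K)),
      absoluteGaloisGroup.toAlgEquiv (v.adicCompletion K) σ t = t := fun σ hσ ↦
    TateCurve.toAlgEquiv_eq_of_mem_inertia_of_sq_eq_gamma W hmult h𝔐 ht2 hσ
  -- the cocycle and a point `a ∈ F(K̄_v)` trivialising it locally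
  obtain ⟨φ, rfl⟩ :=
    oneCocycleClass_surjective (discreteTopRep (absoluteGaloisGroup K) (geomTorsion W (p : ℤ))) c
  obtain ⟨a, ha⟩ := (oneCocycleClass_mem_resKer_iff _ _ _ φ).mp hc
  have ha' : ∀ σ : absoluteGaloisGroup (v.adicCompletion K), pointsMapOfEmb W ι
      ((φ.1 (resGalOfEmb ι σ) : geomTorsion W (p : ℤ)) : geomPoints W) = σ • a - a := fun σ ↦ ha σ
  -- `P = p • a` is rational
  have hPfix : ∀ σ : absoluteGaloisGroup (v.adicCompletion K), σ • ((p : ℤ) • a) = (p : ℤ) • a := by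
    intro σ
    have h0 : (p : ℤ) • (σ • a - a) = 0 := by
      rw [← ha' σ, ← map_zsmul, (mem_geomTorsion_iff W _ _).mp (φ.1 _).2, map_zero]
    rw [W.smul_zsmul_localPoints (p : ℤ) σ a]
    rw [zsmul_sub, sub_eq_zero] at h0
    exact h0
  -- Cor. V.5.4: `P = Ψ(u)`, `u` fixed by the `t`-fixers, `u σ(u) ∈ q^ℤ` for the others
  obtain ⟨u, hufix, hunorm, huP⟩ := hrat ((p : ℤ) • a) hPfix
  have hu0 : (u : AlgebraicClosure (v.adicCompletion K)) ≠ 0 := u.ne_zero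
  have hufix' : ∀ σ : absoluteGaloisGroup (v.adicCompletion K),
      absoluteGaloisGroup.toAlgEquiv (v.adicCompletion K) σ t = t →
        σ • (u : AlgebraicClosure (v.adicCompletion K)) = u := by
    intro σ hσt
    have h := congrArg Units.val (hufix σ hσt)
    rwa [Units.coe_map, MonoidHom.coe_coe] at h
  -- non-split: some `σ₀` moves `t`; the norm relation `u σ₀(u) = q^m`
  obtain ⟨σ₀, hσ₀⟩ := TateCurve.exists_toAlgEquiv_ne_of_not_split W v hmult hns ht2
  obtain ⟨m, hm⟩ := hunorm σ₀ hσ₀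
  -- valuations: `|σ₀ u| = |u|`, so `ν = u² q^{-m} = u/σ₀u` is a unit
  have hwu0 : w (u : AlgebraicClosure (v.adicCompletion K)) ≠ 0 := (Valuation.ne_zero_iff w).mpr hu0
  have hwσu : w ((Units.map (absoluteGaloisGroup.toAlgEquiv (v.adicCompletion K) σ₀ :
      AlgebraicClosure (v.adicCompletion K) →* AlgebraicClosure (v.adicCompletion K)) u :
      (AlgebraicClosure (v.adicCompletion K))ˣ) : AlgebraicClosure (v.adicCompletion K)) =
      w (u : AlgebraicClosure (v.adicCompletion K)) := by
    rw [Units.coe_map, MonoidHom.coe_coe, ← hτ]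
    exact spectralValuation_smul hw σ₀ _
  have hwqm : w (qh ^ m) = w (u : AlgebraicClosure (v.adicCompletion K)) *
      w (u : AlgebraicClosure (v.adicCompletion K)) := by
    rw [← hm, Units.val_mul, map_mul, hwσu]
  have hqm0 : qh ^ m ≠ 0 := zpow_ne_zero m hqh0
  set ν : AlgebraicClosure (v.adicCompletion K) :=
    (u : AlgebraicClosure (v.adicCompletion K)) ^ 2 * (qh ^ m)⁻¹ with hν
  have hνu : ν * qh ^ m = (u : AlgebraicClosure (v.adicCompletion K)) ^ 2 := by
    rw [hν, inv_mul_cancel_right₀ hqm0]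
  have hwν : w ν = 1 := by
    rw [hν, map_mul, map_inv₀, map_pow, hwqm, pow_two, mul_inv_cancel₀ (mul_ne_zero hwu0 hwu0)]
  have hνfix : ∀ σ : absoluteGaloisGroup (v.adicCompletion K),
      absoluteGaloisGroup.toAlgEquiv (v.adicCompletion K) σ t = t → σ • ν = ν := by
    intro σ hσt
    have hu' := hufix' σ hσt
    rw [hτ] at hu' ⊢
    rw [hν, map_mul, map_inv₀, map_pow, map_zpow₀, hu', hqh, AlgEquiv.commutes]
  -- `x = ν^k`, a `p`-th root `ρ` of it
  set x : AlgebraicClosure (v.adicCompletion K) := ν ^ k with hx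
  have hwx : w x = 1 := by rw [hx, map_pow, hwν, one_pow]
  have hx0 : x ≠ 0 := (Valuation.ne_zero_iff w).mp (by rw [hwx]; exact one_ne_zero)
  have hxfix : ∀ σ : absoluteGaloisGroup (v.adicCompletion K),
      absoluteGaloisGroup.toAlgEquiv (v.adicCompletion K) σ t = t → σ • x = x := fun σ h ↦ by
    rw [hx, smul_pow', hνfix σ h]
  obtain ⟨ρ, hρ⟩ := IsAlgClosed.exists_pow_nat_eq x hpp.pos
  have hρ0 : ρ ≠ 0 := by
    rintro rfl
    rw [zero_pow hpp.ne_zero] at hρ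
    exact hx0 hρ.symm
  have hwρ : w ρ = 1 := by
    have h1 : w ρ ^ p = 1 := by rw [← map_pow, hρ, hwx]
    exact (pow_eq_one_iff_of_nonneg zero_le hpp.ne_zero).mp h1
  have hwp : w (p : AlgebraicClosure (v.adicCompletion K)) = 1 := by
    have hv' : ((p : ℤ) : 𝓞 K) ∉ v.asIdeal := by rwa [Int.cast_natCast]
    have h := spectralValuation_intCast_eq_one hw hv'
    rwa [Int.cast_natCast] at h
  -- the inertia group fixes `ρ` (a `p`-th root of the invariant unit `x`, `p ∤ v`)
  have hIρ : ∀ σ ∈ 𝔐.inertia (absoluteGaloisGroup (v.adicCompletion K)), σ • ρ = ρ := by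
    intro σ hσ
    have hσx : σ • x = x := hxfix σ (hIt σ hσ)
    have hlt : w (σ • ρ - ρ) < 1 := (mem_inertia_iff_spectralValuation hw h𝔐).mp hσ ρ hwρ.le
    set η : AlgebraicClosure (v.adicCompletion K) := σ • ρ * ρ⁻¹ with hη
    have hηp : η ^ p = 1 := by
      rw [hη, mul_pow, ← smul_pow', hρ, hσx, inv_pow, hρ, mul_inv_cancel₀ hx0]
    have hη1 : w (η - 1) < 1 := by
      have e : η - 1 = (σ • ρ - ρ) * ρ⁻¹ := by rw [hη]; field_simp
      rw [e, map_mul, map_inv₀, hwρ, inv_one, mul_one]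
      exact hlt
    have hη1' : η = 1 := eq_one_of_pow_eq_one_of_val_sub_lt_one w hpp.ne_zero hwp hηp hη1
    calc σ • ρ = η * ρ := by rw [hη, inv_mul_cancel_right₀ hρ0]
      _ = ρ := by rw [hη1', one_mul]
  -- the unit `ρ u⁻¹` and the key identity `(ρ u⁻¹)^p = u q^{-mk}`
  set wu : (AlgebraicClosure (v.adicCompletion K))ˣ := Units.mk0 ρ hρ0 * u⁻¹ with hwu
  set qu : (AlgebraicClosure (v.adicCompletion K))ˣ := Units.mk0 qh hqh0 with hqu
  have hkey : wu ^ p = u * qu ^ (-(m * k)) := by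
    rw [zpow_neg, eq_mul_inv_iff_mul_eq]
    apply Units.ext
    rw [Units.val_mul, Units.val_pow_eq_pow_val, Units.val_zpow_eq_zpow_val, hwu, Units.val_mul,
      Units.val_mk0, Units.val_inv_eq_inv_val, hqu, Units.val_mk0, mul_pow, inv_pow, hρ, hx, zpow_mul,
      zpow_natCast, mul_right_comm, ← mul_pow, hνu, ← pow_mul, ← hk, pow_succ,
      mul_comm ((u : AlgebraicClosure (v.adicCompletion K)) ^ p), mul_inv_cancel_right₀ (pow_ne_zero p hu0)]
  have hΨq : Ψ (Additive.ofMul qu) = 0 := (hker qu).mpr ⟨1, by rw [hqu, Units.val_mk0, zpow_one]⟩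
  -- `Q = Ψ(ρ u⁻¹)` with `p Q = P`, fixed by the inertia group
  set Q : localPoints W (v.adicCompletion K) := Ψ (Additive.ofMul wu) with hQ
  have hpQ : (p : ℤ) • Q = (p : ℤ) • a := by
    rw [hQ, ← map_zsmul, ← ofMul_zpow, zpow_natCast, hkey, ofMul_mul, map_add, huP, ofMul_zpow, map_zsmul,
      hΨq, zsmul_zero, add_zero]
  have hIQ : ∀ σ ∈ 𝔐.inertia (absoluteGaloisGroup (v.adicCompletion K)), σ • Q = Q := by
    intro σ hσ
    have hσwu : Units.map (absoluteGaloisGroup.toAlgEquiv (v.adicCompletion K) σ :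
        AlgebraicClosure (v.adicCompletion K) →* AlgebraicClosure (v.adicCompletion K)) wu = wu := by
      apply Units.ext
      rw [Units.coe_map, MonoidHom.coe_coe, hwu, Units.val_mul, Units.val_mk0, Units.val_inv_eq_inv_val,
        map_mul, map_inv₀, ← hτ, ← hτ, hIρ σ hσ, hufix' σ (hIt σ hσ)]
    rw [hQ, hequiv σ wu, if_pos (hIt σ hσ), one_zsmul, hσwu]
  -- `T = a - Q ∈ F(K̄_v)[p]` comes from `T₀ ∈ F[p](K̄)`
  set T : localPoints W (v.adicCompletion K) := a - Q with hT
  have hTp : (p : ℤ) • T = 0 := by rw [hT, zsmul_sub, hpQ, sub_self]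
  obtain ⟨T₀, hT₀⟩ := exists_geomTorsion_pointsMapOfEmb_eq W hn ι hTp
  -- on `I_𝔓`, `φ` is the coboundary of `T₀`
  refine (oneCocycleClass_mem_subgroupResKer_iff _ φ).mpr ⟨T₀, fun τ ↦ ?_⟩
  obtain ⟨σ, hσI, hσ⟩ := HeightOneSpectrum.exists_mem_inertia_apply_eq_holds v ι h𝔐 τ.2
  have hres : resGalOfEmb ι σ = (τ : absoluteGaloisGroup K) := resGalOfEmb_eq_of_apply_eq ι hσ
  apply Subtype.ext
  apply pointsMapOfEmb_injective W ι
  rw [AddSubgroupClass.coe_sub, map_sub, Literature.NumberTheory.EllipticCurves.AddSubgroup.torsionBy.coe_smul,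
    ← hres, pointsMapOfEmb_smul, hT₀, ha' σ, hT, smul_sub, hIQ σ hσI]
  abel

/-! ### §2 Theorem M at every prime above `v` -/

/-- **M. The local Kummer condition at a non-split multiplicative place `v ∤ p`, `p` odd, is unramified**: for an elliptic
curve `F = W` over a number field `K` with NON-SPLIT multiplicative reduction at `v`, `(p) ⊄ v`, and every prime `𝔓` of
`\bar ℤ_K` above `v`, `selmerLocalKer F K_v p ≤ unramifiedKer F[p] 𝔓` (the tree convention: the chosen embedding
`K̄ → K̄_v`; the kernel does not depend on it, `selmerLocalKer_eq_of_algHom_holds`, and `Γ_K` is transitive on the primes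
above `v`, `exists_smul_eq_of_mem_primesAbove_holds`). Classical content: Schaefer–Stoll Prop. 3.2 / Milne *ADT* I 3.8
at a place with `p ∤ c_v(F)` (`c_v ∈ {1, 2}` for non-split `I_n`). [cite: SilvermanATAEC1994, Ch. V Thm. 5.3, Cor. 5.4]
[cite: MilneADT2006, I Prop. 3.8] [cite: Fisher2016Visualizing7, Thm. 4.4 (p. 106)] -/
theorem selmerLocalKer_le_unramifiedKer_of_nonsplit (hp2 : p ≠ 2)
    (hv : (p : 𝓞 K) ∉ v.asIdeal) (hmult : W.HasMultiplicativeReductionAt v)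
    (hns : ¬ W.HasSplitMultiplicativeReductionAt v)
    {𝔓 : Ideal (absIntegers (𝓞 K) K)} (h𝔓 : 𝔓 ∈ v.primesAbove) :
    selmerLocalKer W (v.adicCompletion K) (p : ℤ) ≤ unramifiedKer (geomTorsion W (p : ℤ)) 𝔓 := by
  obtain ⟨𝔐, h𝔐⟩ := v.localPrimesAbove_nonempty
  obtain ⟨g, hg⟩ := HeightOneSpectrum.exists_smul_eq_of_mem_primesAbove_holds
    (HeightOneSpectrum.primeBelow_mem_primesAbove
      (ι := closureEmb (K := K) (v.adicCompletion K)) h𝔐) h𝔓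
  have h1 : 𝔓 = v.primeBelow ((closureEmb (K := K) (v.adicCompletion K)).comp
      ((show AlgebraicClosure K ≃ₐ[K] AlgebraicClosure K from g⁻¹) :
        AlgebraicClosure K →ₐ[K] AlgebraicClosure K)) 𝔐 := by
    rw [HeightOneSpectrum.primeBelow_comp, ← hg]
    exact congrArg (· • _) (inv_inv g).symm
  rw [h1, ← selmerLocalKer_eq_of_algHom_holds W (v.adicCompletion K) _ (p : ℤ)]
  exact selmerLocalKerOfEmb_le_unramifiedKer_primeBelow_of_nonsplit W v hp2 hv hmult hns _ h𝔐

/-! ### §3 Kind (iv) of the visibility certificate, orientation «`E` good, `E'` non-split multiplicative», fact-free -/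

/-- **C1. The local Kummer conditions of `p`-congruent curves agree at `v ∤ p` (`p` odd) when `E` is GOOD and `E'` is
NON-SPLIT multiplicative at `v`** (Fisher 2016 Thm. 4.4, the projection consumed by the visibility records, PROVED): for
`θ : E'[p] ⥲ E[p]` `Γ_K`-equivariant and `c ∈ 𝓢_v(E')`, `θ_* c ∈ 𝓢_v(E)`. Proof: `c` is unramified at a prime `𝔓 ∣ v`
(M), so is `θ_* c` (`mem_unramifiedKer_iff_h1Equiv_mem`), and at the good place `v ∤ p` unramified = Selmer
(`selmerLocalKer_eq_unramifiedKer`, Gross (7.1)). [cite: Fisher2016Visualizing7, Thm. 4.4 (p. 106)]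
[cite: GrossLMS1991, §7 (7.1)] -/
theorem h1Equiv_mem_selmerLocalKer_of_hasGoodReductionAt_of_nonsplit (hp2 : p ≠ 2)
    (W' : WeierstrassCurve K) [W'.IsElliptic]
    (θ : geomTorsion W' (p : ℤ) ≃+ geomTorsion W (p : ℤ))
    (hθ : ∀ (σ : absoluteGaloisGroup K) (P : geomTorsion W' (p : ℤ)), θ (σ • P) = σ • θ P)
    (hv : (p : 𝓞 K) ∉ v.asIdeal) (hW : W.HasGoodReductionAt v)
    (hW'm : W'.HasMultiplicativeReductionAt v) (hW'ns : ¬ W'.HasSplitMultiplicativeReductionAt v)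
    {c : galH1Torsion W' (p : ℤ)} (hc : c ∈ selmerLocalKer W' (v.adicCompletion K) (p : ℤ)) :
    h1Equiv θ hθ c ∈ selmerLocalKer W (v.adicCompletion K) (p : ℤ) := by
  obtain ⟨𝔓, h𝔓⟩ := v.primesAbove_nonempty
  have hn : ((p : ℤ) : 𝓞 K) ∉ v.asIdeal := by rwa [Int.cast_natCast]
  have h1 : c ∈ unramifiedKer (geomTorsion W' (p : ℤ)) 𝔓 :=
    selmerLocalKer_le_unramifiedKer_of_nonsplit W' v hp2 hv hW'm hW'ns h𝔓 hc
  rw [W.selmerLocalKer_eq_unramifiedKer hW hn h𝔓, ← mem_unramifiedKer_iff_h1Equiv_mem]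
  exact h1

/-- **`ι_v(θ) = 1` at a place `v ∤ p` (`p` odd) where `E` is good and `E'` non-split multiplicative** (the comparison
index of `CongruenceVisibilityComparison.lean`), fact-free. [cite: Fisher2016Visualizing7, Thm. 4.4 (p. 106)] -/
theorem relIndex_map_selmerLocalKer_eq_one_of_hasGoodReductionAt_of_nonsplit (hp2 : p ≠ 2)
    (W' : WeierstrassCurve K) [W'.IsElliptic]
    (θ : geomTorsion W' (p : ℤ) ≃+ geomTorsion W (p : ℤ))
    (hθ : ∀ (σ : absoluteGaloisGroup K) (P : geomTorsion W' (p : ℤ)), θ (σ • P) = σ • θ P)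
    (hv : (p : 𝓞 K) ∉ v.asIdeal) (hW : W.HasGoodReductionAt v)
    (hW'm : W'.HasMultiplicativeReductionAt v) (hW'ns : ¬ W'.HasSplitMultiplicativeReductionAt v) :
    (selmerLocalKer W (v.adicCompletion K) (p : ℤ)).relIndex
        ((selmerLocalKer W' (v.adicCompletion K) (p : ℤ)).map (h1Equiv θ hθ).toAddMonoidHom) = 1 :=
  (relIndex_map_selmerLocalKer_eq_one_iff W W' θ hθ).mpr fun _ hc ↦
    h1Equiv_mem_selmerLocalKer_of_hasGoodReductionAt_of_nonsplit W v hp2 W' θ hθ hv hW hW'm hW'ns hc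

/-! ### §4 The four-kind visibility certificate WITHOUT named-fact binders -/

/-- **Visible `Ш(E/K)[p] ≠ 0` from a `p`-congruent curve — PAY at the places of `T`, AGREE elsewhere, with NO named-fact binder.**
The shape of `WeierstrassCurve.exists_sha_ne_zero_of_congr_of_places₄` (`Fisher2016/CongruentKummerConditions.lean`: odd `p`,
`θ : E'[p] ⥲ E[p]`, finite sets `T ⊆ S` of finite places with `E, E'` good and `v ∤ p` outside `S`, `E(K)` finite of order prime to
`p`, the places of `T` paid for by `∏_{v ∈ T} #E'(K_v)[p] · #(𝓞_v/p) < p^{rank E'(K)}`), every place of `S \ T` being of one of FOUR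
free kinds: (i) `v ∤ p` and `E'(K_v)[p] = 0`; (ii) both curves split multiplicative and `#E(K_v)[p] ≤ p`; (iii) both multiplicative,
`γ(E) = r²γ(E')` in `K_v`, `μ_p(K_v) = 1`; **(iv′) `v ∤ p`, `E` GOOD and `E'` NON-SPLIT multiplicative at `v`**. The Tate-uniformisation
facts of kinds (ii)/(iii) are the tree's PROVED `TateCurve.Silverman1994_thmV53_tateUniformisation_holds` /
`…corV54_tateUniformisation_holds`, and kind (iv′) is §3 — so NOTHING is displayed; over `K = ℚ` it applies verbatim. (Kind (iv) of the original in the other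
orientation, or at `v ∣ p`, still needs Fisher's Thm. 4.4 as a named fact.) [cite: CremonaMazur2000, §3 and Table 1]
[cite: AgasheStein2002, Thm. 3.1 and §3.5] [cite: SilvermanATAEC1994, Ch. V Thm. 3.1, Lemma 5.2, Thm. 5.3, Cor. 5.4]
[cite: Fisher2016Visualizing7, Thm. 4.4 (p. 106)] -/
theorem exists_sha_ne_zero_of_congr_of_places₄_factFree (hp2 : p ≠ 2)
    (W' : WeierstrassCurve K) [W'.IsElliptic]
    (θ : geomTorsion W' (p : ℤ) ≃+ geomTorsion W (p : ℤ))
    (hθ : ∀ (σ : absoluteGaloisGroup K) (P : geomTorsion W' (p : ℤ)), θ (σ • P) = σ • θ P)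
    (S T : Finset (HeightOneSpectrum (𝓞 K))) (hTS : T ⊆ S)
    (hS : ∀ w : HeightOneSpectrum (𝓞 K), w ∉ S →
      W.HasGoodReductionAt w ∧ W'.HasGoodReductionAt w ∧ (p : 𝓞 K) ∉ w.asIdeal)
    (hfin : Finite W.toAffine.Point) (hcop : (Nat.card W.toAffine.Point).Coprime p)
    (hT : (∏ w ∈ T, Nat.card (nsmulAddMonoidHom p :
        (W'.baseChange (w.adicCompletion K)).toAffine.Point →+ _).ker *
        Nat.card (w.adicCompletionIntegers K ⧸
          Ideal.span {(p : w.adicCompletionIntegers K)})) < p ^ W'.mordellWeilRank)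
    (hplaces : ∀ w ∈ S, w ∉ T →
      ((p : 𝓞 K) ∉ w.asIdeal ∧ Nat.card (nsmulAddMonoidHom p :
          (W'.baseChange (w.adicCompletion K)).toAffine.Point →+ _).ker = 1) ∨
      (W.HasSplitMultiplicativeReductionAt w ∧ W'.HasSplitMultiplicativeReductionAt w ∧
        Nat.card (nsmulAddMonoidHom p :
          (W.baseChange (w.adicCompletion K)).toAffine.Point →+ _).ker ≤ p) ∨
      (W.HasMultiplicativeReductionAt w ∧ W'.HasMultiplicativeReductionAt w ∧
        (∃ r : w.adicCompletion K, algebraMap K (w.adicCompletion K) (-(W.c₄ / W.c₆)) =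
          r ^ 2 * algebraMap K (w.adicCompletion K) (-(W'.c₄ / W'.c₆))) ∧
        (∀ ζ : w.adicCompletion K, ζ ^ p = 1 → ζ = 1)) ∨
      ((p : 𝓞 K) ∉ w.asIdeal ∧ W.HasGoodReductionAt w ∧ W'.HasMultiplicativeReductionAt w ∧
        ¬ W'.HasSplitMultiplicativeReductionAt w)) :
    ∃ c : W.sha, c ≠ 0 ∧ p • c = 0 := by
  have hpp : p.Prime := hp.out
  haveI := hfin
  refine exists_sha_ne_zero_of_congr_of_le_off W W' hp2 θ hθ S T hTS hS (fun w hw hwT c hc ↦ ?_) ?_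
  · rcases hplaces w hw hwT with ⟨hwp, hloc⟩ | ⟨hWw, hW'w, hcardw⟩ | ⟨hWw, hW'w, hγw, hμw⟩ |
        ⟨hwp, hWg, hW'm, hW'ns⟩
    · exact (relIndex_map_selmerLocalKer_eq_one_iff W W' θ hθ).mp
        (relIndex_map_selmerLocalKer_eq_one_of_card_torsion_eq_one W W' θ hθ hwp hloc) c hc
    · exact W.h1Equiv_mem_selmerLocalKer_of_hasSplitMultiplicativeReductionAt w
        TateCurve.Silverman1994_thmV53_tateUniformisation_holds W' θ hθ hWw hW'w hcardw hc
    · exact W.h1Equiv_mem_selmerLocalKer_of_hasMultiplicativeReductionAt w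
        TateCurve.Silverman1994_thmV53_corV54_tateUniformisation_holds hp2 W' θ hθ hWw hW'w hγw hμw hc
    · exact h1Equiv_mem_selmerLocalKer_of_hasGoodReductionAt_of_nonsplit W w hp2 W' θ hθ hwp hWg hW'm
        hW'ns hc
  · rw [index_range_zsmul_eq_one_of_coprime hcop, one_mul,
      Finset.prod_congr rfl fun w _ ↦
        (W'.natCard_kummerLocalConditionAt_adicCompletion w hpp.ne_zero)]
    exact lt_of_lt_of_le hT (pow_mordellWeilRank_le_index_range_zsmul W' hpp.ne_zero)

end Summit.BirchSwinnertonDyer.BirchSwinnertonDyer.Theorems.NonsplitKummerUnramified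

end
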